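import Summits.ValiantsHypothesis.ValiantsHypothesis.Theorems.BarrierLeverAnchoredDoorHitsLowerPairsStarExcessOnePrelims

/-!
# Route BarrierLever — support item `AnchoredDoorHitsLowerPairs` (stmt-ValiantsHypothesis-22510), line `anchored_peeling`:
# EVERY LOWER PAIR OF EXCESS ONE IS STAR-GOOD

Helper file (`--supports stmt-ValiantsHypothesis-22510`; val-np-p1 g34). Door slot of record `Stmt.conjStarLower`. Closes NO item;
nothing here bears on crux 14610 or on `VP ≠ VNP`, which is NOT proved.

**THEOREM (`starDet_ne_zero_of_excessOne`).** Every pair of injective enumerations `u, w` of lower families with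
`r = n₁ + n₂ + 2` (`n_k` = number of faces of size one; EXCESS `ε = r − 1 − n₁ − n₂ = 1`, the first face-rich layer beyond the
vertex-rich theorem `starDet_ne_zero_of_vertexRich` of …StarVertexRich) is STAR-GOOD; door / item level
`symbolicDet_two_ne_zero_of_excessOne`, `anchoredHit_two_of_excessOne`. With …StarVertexRich: every injective lower pair with
`r ≤ n₁ + n₂ + 2` is star-good (`starDet_ne_zero_of_excess_le_one`).

PROOF (a two-centre 0/1 DESIGN, …StarTwoCentreDesign/Det, with `𝓐* = {A*}`, `𝓢* = {S*}` faces of MAXIMUM size — hence up-closed —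
and a 1 × 1 design matrix `(t)`, `t` = a count of two-centre star forests; the seatings are chosen so that `t ≥ 1`):
* `|A*| ≥ 3`, `|S*| ≥ 3`: seat a vertex `e₀ ∈ S*` on the ridge `A* ∖ b₀` and `b₀` on `S* ∖ e₀`: the double star with centres `b₀, e₀` counts.
* `|A*| ≥ 3`, all big column faces are edges (`S* = {e, e'}`): seat `e`, `e'` on two different ridges of `A*`: the forest «both column
  vertices centres» counts. The mirror case by the swap symmetry.
* both sides graphs: some side has more edges than vertices, hence (leaf counting, `exists_edge_two_sided`) an edge both of whose endpoints
  lie on a second edge; take it as `S*` (resp. `A*`) and seat the two endpoints of the other side's `A*` (resp. `S*`) on those second edges.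

ERRATUM TO …StarTwoCentre (val-np-p1 g34, kit j336933 + lab/simplex_t2.py). The node `Stmt.conjStarTwoCentre` («the two-centre matrix is
nonsingular on EVERY face-rich pair») is FALSE as stated: the two-centre matrix is a sum of blocks of ranks `≤ 1`, `n₁`, `n₂`, `n₁n₂`
(double stars factor through `X × Y`), `|I₂|`, `|J₂|`, so it is singular whenever `r > 1 + n₁ + n₂ + n₁n₂ + |I₂| + |J₂|` — e.g. for
`u = w =` an enumeration of `2^{[7]}` (`r = 128 > 106`), a pair that is trivially star-good. The census behind the node (every pair on
`≤ 5+5` vertices; random pairs below the rank bound) stands; the valid replacement node for the door slot is `Stmt.conjStarLowerFaceRich`.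
The two-centre device and the designs below are CERTIFICATES for moderately face-rich pairs, not a conjecture about all of them.
-/

set_option linter.dupNamespace false

namespace Summit.ValiantsHypothesis.ValiantsHypothesis.Theorems.BarrierLever.AnchoredPeeling

open Finset

noncomputable section

namespace StarDoor

variable {h r : ℕ}

section ExcessOne

variable (u w : Fin r → Finset (Fin h))

/-! ## 5. The cases -/

/-- **Case: the largest row face has `≥ 3` vertices** (any column side). -/
theorem excessOne_case_rowThree (hu : Function.Injective u) (hw : Function.Injective w)
    (hlu : IsLowerSet (Set.range u)) (hlw : IsLowerSet (Set.range w)) (hr : 0 < r)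
    {is js : Fin r} (hbi : 2 ≤ (u is).card) (hbj : 2 ≤ (w js).card)
    (hmi : ∀ i', 2 ≤ (u i').card → (u i').card ≤ (u is).card) (hmj : ∀ j', 2 ≤ (w j').card → (w j').card ≤ (w js).card)
    (hp₁ : (univ.filter fun i => 2 ≤ (u i).card).card = (univ.filter fun j => (w j).card = 1).card + 1)
    (hp₂ : (univ.filter fun j => 2 ≤ (w j).card).card = (univ.filter fun i => (u i).card = 1).card + 1)
    (h3 : 3 ≤ (u is).card) :
    ∃ g d : Fin h → Fin h → ℂ, (Matrix.of fun i j : Fin r => starEntry g d (u i) (w j)).det ≠ 0 := by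
  classical
  have hcα := card_seats u w hbi hp₁
  have hcβ := card_seats w u hbj hp₂
  -- two distinct row vertices `b₁ ≠ b₂` of `A*`, their ridges and the indices of the ridges
  obtain ⟨b₁, hb₁, b₂, hb₂, hb12⟩ := Finset.one_lt_card.mp (show 1 < (u is).card by omega)
  have ridge : ∀ b ∈ u is, ∃ iF : Fin r, u iF = (u is).erase b ∧ 2 ≤ (u iF).card ∧ iF ∉ ({is} : Finset (Fin r)) := by
    intro b hb
    obtain ⟨iF, hiF⟩ := exists_index_of_subset hlu (Finset.erase_subset b (u is))
    refine ⟨iF, hiF, by rw [hiF, Finset.card_erase_of_mem hb]; omega, ?_⟩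
    rw [Finset.mem_singleton]; intro h0; rw [h0] at hiF
    have := Finset.card_erase_of_mem hb; rw [← hiF] at this; omega
  obtain ⟨i₁, hi₁, hi₁b, hi₁s⟩ := ridge b₁ hb₁
  obtain ⟨i₂, hi₂, hi₂b, hi₂s⟩ := ridge b₂ hb₂
  -- vertex indices
  have vtxJ : ∀ e ∈ w js, ∃ j : Fin r, w j = {e} := fun e he =>
    exists_index_of_subset hlw (Finset.singleton_subset_iff.mpr he)
  have vtxI : ∀ b ∈ u is, ∃ i : Fin r, u i = {b} := fun b hb =>
    exists_index_of_subset hlu (Finset.singleton_subset_iff.mpr hb)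
  by_cases h3j : 3 ≤ (w js).card
  · -- DOUBLE STAR with centres `b₁`, `e₀`: seat `e₀` on the ridge `A* ∖ b₁`, `b₁` on the ridge `S* ∖ e₀`
    obtain ⟨e₀, he₀⟩ := Finset.card_pos.mp (show 0 < (w js).card by omega)
    obtain ⟨j₀, hj₀⟩ := vtxJ e₀ he₀
    obtain ⟨i₀, hi₀⟩ := vtxI b₁ hb₁
    obtain ⟨jG, hjG⟩ := exists_index_of_subset hlw (Finset.erase_subset e₀ (w js))
    have hjGb : 2 ≤ (w jG).card := by rw [hjG, Finset.card_erase_of_mem he₀]; omega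
    have hjGs : jG ∉ ({js} : Finset (Fin r)) := by
      rw [Finset.mem_singleton]; intro h0; rw [h0] at hjG
      have := Finset.card_erase_of_mem he₀; rw [← hjG] at this; omega
    obtain ⟨α, hα⟩ := exists_equiv_apply_eq hcα ⟨j₀, by rw [hj₀, Finset.card_singleton]⟩ ⟨i₁, hi₁b, hi₁s⟩
    obtain ⟨β, hβ⟩ := exists_equiv_apply_eq hcβ ⟨i₀, by rw [hi₀, Finset.card_singleton]⟩ ⟨jG, hjGb, hjGs⟩
    refine starDet_ne_zero_of_singleton_design u w hu hw hlu hlw hr hbi hbj hmi hmj α β ?_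
    refine one_le_twoTop_of_term _ _ (seatG_nonneg u w _) (seatD_nonneg u w _)
      (Finset.singleton_subset_iff.mpr hb₁) (Finset.singleton_subset_iff.mpr he₀) ?_ ?_
    · unfold scDeg tcPot bigInd
      rw [Finset.card_sdiff_of_subset (Finset.singleton_subset_iff.mpr hb₁),
        Finset.card_sdiff_of_subset (Finset.singleton_subset_iff.mpr he₀), Finset.card_singleton, Finset.card_singleton,
        if_pos hbi, if_pos hbj]
    · rw [scCoef_doubleStar, Finset.prod_eq_one, Finset.prod_eq_one, mul_one]
      · intro e he
        refine seatD_eq_one u w _ ⟨i₀, by rw [hi₀, Finset.card_singleton]⟩ hi₀ ?_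
        rw [hβ, hjG, ← Finset.sdiff_singleton_eq_erase]; exact he
      · intro b hb
        refine seatG_eq_one u w _ ⟨j₀, by rw [hj₀, Finset.card_singleton]⟩ hj₀ ?_
        rw [hα, hi₁, ← Finset.sdiff_singleton_eq_erase]; exact hb
  · -- `S* = {e₁, e₂}`: seat `e₁` on `A* ∖ b₁` and `e₂` on `A* ∖ b₂`; the forest «both column vertices centres» counts
    have hS2 : (w js).card = 2 := by omega
    obtain ⟨e₁, e₂, he12, hS⟩ := Finset.card_eq_two.mp hS2
    obtain ⟨j₁, hj₁⟩ := vtxJ e₁ (by rw [hS]; simp)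
    obtain ⟨j₂, hj₂⟩ := vtxJ e₂ (by rw [hS]; simp)
    have hj12 : (⟨j₁, by rw [hj₁, Finset.card_singleton]⟩ : {j : Fin r // (w j).card = 1}) ≠
        ⟨j₂, by rw [hj₂, Finset.card_singleton]⟩ := by
      intro h0; have h1 : j₁ = j₂ := congrArg Subtype.val h0
      rw [h1] at hj₁; rw [hj₁] at hj₂; exact he12 (Finset.singleton_injective hj₂)
    have hi12 : (⟨i₁, hi₁b, hi₁s⟩ : {i : Fin r // 2 ≤ (u i).card ∧ i ∉ ({is} : Finset (Fin r))}) ≠ ⟨i₂, hi₂b, hi₂s⟩ := by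
      intro h0; have h1 : i₁ = i₂ := congrArg Subtype.val h0
      have : b₂ ∈ u i₁ := by rw [hi₁]; exact Finset.mem_erase.mpr ⟨fun h' => hb12 h'.symm, hb₂⟩
      rw [h1, hi₂] at this; exact (Finset.mem_erase.mp this).1 rfl
    obtain ⟨α, hα₁, hα₂⟩ := exists_equiv_apply_eq₂ hcα hj12 hi12
    let β : {i : Fin r // (u i).card = 1} ≃ {j : Fin r // 2 ≤ (w j).card ∧ j ∉ ({js} : Finset (Fin r))} :=
      Fintype.equivOfCardEq hcβ
    refine starDet_ne_zero_of_singleton_design u w hu hw hlu hlw hr hbi hbj hmi hmj α β ?_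
    refine one_le_twoTop_of_term _ _ (seatG_nonneg u w _) (seatD_nonneg u w _)
      (Finset.empty_subset _) subset_rfl ?_ ?_
    · unfold scDeg tcPot bigInd
      rw [Finset.sdiff_empty, Finset.sdiff_self, Finset.card_empty, if_pos hbi, if_pos hbj, hS2]; omega
    · rw [scCoef_allCols]
      refine one_le_prod_int _ _ fun b hb => ?_
      by_cases hbb : b = b₁
      · -- `b₁ ∈ A* ∖ b₂`, seen from `e₂`
        have hmem : b ∈ u (α ⟨j₂, by rw [hj₂, Finset.card_singleton]⟩).1 := by
          rw [hα₂, hi₂]; exact Finset.mem_erase.mpr ⟨by rw [hbb]; exact hb12, hb⟩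
        have h1 := seatG_eq_one u w (fun j => (α j).1) ⟨j₂, by rw [hj₂, Finset.card_singleton]⟩ hj₂ hmem
        calc (1 : ℤ) = seatG u w (fun j => (α j).1) ℤ b e₂ := h1.symm
          _ ≤ ∑ e ∈ w js, seatG u w (fun j => (α j).1) ℤ b e :=
            Finset.single_le_sum (fun e _ => seatG_nonneg u w _ b e) (by rw [hS]; simp)
      · have hmem : b ∈ u (α ⟨j₁, by rw [hj₁, Finset.card_singleton]⟩).1 := by
          rw [hα₁, hi₁]; exact Finset.mem_erase.mpr ⟨hbb, hb⟩
        have h1 := seatG_eq_one u w (fun j => (α j).1) ⟨j₁, by rw [hj₁, Finset.card_singleton]⟩ hj₁ hmem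
        calc (1 : ℤ) = seatG u w (fun j => (α j).1) ℤ b e₁ := h1.symm
          _ ≤ ∑ e ∈ w js, seatG u w (fun j => (α j).1) ℤ b e :=
            Finset.single_le_sum (fun e _ => seatG_nonneg u w _ b e) (by rw [hS]; simp)

/-- **Leaf counting:** if a side has more big faces than vertices, some big face has every vertex on a second big face
(a big face with a private vertex is charged to that vertex, injectively). -/
theorem exists_edge_two_sided (v : Fin r → Finset (Fin h)) (hlv : IsLowerSet (Set.range v))
    (hmore : (univ.filter fun j => (v j).card = 1).card < (univ.filter fun j => 2 ≤ (v j).card).card) :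
    ∃ js : Fin r, 2 ≤ (v js).card ∧ ∀ e ∈ v js, ∃ jG : Fin r, 2 ≤ (v jG).card ∧ jG ≠ js ∧ e ∈ v jG := by
  classical
  by_contra hcon
  push Not at hcon
  -- every edge has a LEAF endpoint; edge ↦ the vertex index of a leaf endpoint is injective
  have hleaf : ∀ js ∈ (univ.filter fun j => 2 ≤ (v j).card), ∃ e ∈ v js, ∀ jG, 2 ≤ (v jG).card → jG ≠ js → e ∉ v jG :=
    fun js hjs => hcon js (Finset.mem_filter.mp hjs).2
  choose ℓ hℓmem hℓ using hleaf
  have hidx : ∀ js (hjs : js ∈ (univ.filter fun j => 2 ≤ (v j).card)), ∃ jv : Fin r, v jv = {ℓ js hjs} := fun js hjs =>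
    exists_index_of_subset hlv (Finset.singleton_subset_iff.mpr (hℓmem js hjs))
  choose jv hjv using hidx
  let f : Fin r → Fin r := fun js => if hjs : js ∈ (univ.filter fun j => 2 ≤ (v j).card) then jv js hjs else js
  have hf : ∀ js (hjs : js ∈ (univ.filter fun j => 2 ≤ (v j).card)), f js = jv js hjs := fun js hjs => by
    simp only [f, dif_pos hjs]
  have hmaps : ∀ js ∈ (univ.filter fun j => 2 ≤ (v j).card), f js ∈ (univ.filter fun j => (v j).card = 1) := fun js hjs => by
    rw [hf js hjs]; simp only [Finset.mem_filter, Finset.mem_univ, true_and]; rw [hjv js hjs, Finset.card_singleton]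
  have hinj : Set.InjOn f (univ.filter fun j => 2 ≤ (v j).card : Finset (Fin r)) := by
    intro j hj j' hj' hjj
    rw [hf j hj, hf j' hj'] at hjj
    have he : ℓ j hj = ℓ j' hj' :=
      Finset.singleton_injective ((hjv j hj).symm.trans ((congrArg v hjj).trans (hjv j' hj')))
    by_contra hne
    have := hℓ j hj j' (Finset.mem_filter.mp hj').2 (fun h0 => hne h0.symm)
    rw [he] at this; exact this (hℓmem j' hj')
  have := Finset.card_le_card_of_injOn f hmaps hinj
  omega

/-- **Case: both sides are graphs and the column side has more edges than vertices.** -/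
theorem excessOne_case_graphs (hu : Function.Injective u) (hw : Function.Injective w)
    (hlu : IsLowerSet (Set.range u)) (hlw : IsLowerSet (Set.range w)) (hr : 0 < r)
    (hall2u : ∀ i, 2 ≤ (u i).card → (u i).card = 2) (hall2w : ∀ j, 2 ≤ (w j).card → (w j).card = 2)
    (hp₁ : (univ.filter fun i => 2 ≤ (u i).card).card = (univ.filter fun j => (w j).card = 1).card + 1)
    (hp₂ : (univ.filter fun j => 2 ≤ (w j).card).card = (univ.filter fun i => (u i).card = 1).card + 1)
    (hmore : (univ.filter fun j => (w j).card = 1).card < (univ.filter fun j => 2 ≤ (w j).card).card) :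
    ∃ g d : Fin h → Fin h → ℂ, (Matrix.of fun i j : Fin r => starEntry g d (u i) (w j)).det ≠ 0 := by
  classical
  obtain ⟨js, hbj, hG⟩ := exists_edge_two_sided w hlw hmore
  -- a row edge `A* = {b₁, b₂}`
  have hne : (univ.filter fun i => 2 ≤ (u i).card).Nonempty := Finset.card_pos.mp (by omega)
  obtain ⟨is, his⟩ := hne
  have hbi : 2 ≤ (u is).card := (Finset.mem_filter.mp his).2
  have hmi : ∀ i', 2 ≤ (u i').card → (u i').card ≤ (u is).card := fun i' hi' => by rw [hall2u i' hi', hall2u is hbi]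
  have hmj : ∀ j', 2 ≤ (w j').card → (w j').card ≤ (w js).card := fun j' hj' => by rw [hall2w j' hj', hall2w js hbj]
  have hcα := card_seats u w hbi hp₁
  have hcβ := card_seats w u hbj hp₂
  obtain ⟨b₁, b₂, hb12, hA⟩ := Finset.card_eq_two.mp (hall2u is hbi)
  obtain ⟨e₁, e₂, he12, hS⟩ := Finset.card_eq_two.mp (hall2w js hbj)
  obtain ⟨jG₁, hG₁b, hG₁s, he₁⟩ := hG e₁ (by rw [hS]; simp)
  obtain ⟨jG₂, hG₂b, hG₂s, he₂⟩ := hG e₂ (by rw [hS]; simp)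
  obtain ⟨i₁, hi₁⟩ := exists_index_of_subset hlu (Finset.singleton_subset_iff.mpr (show b₁ ∈ u is by rw [hA]; simp))
  obtain ⟨i₂, hi₂⟩ := exists_index_of_subset hlu (Finset.singleton_subset_iff.mpr (show b₂ ∈ u is by rw [hA]; simp))
  have hi12 : (⟨i₁, by rw [hi₁, Finset.card_singleton]⟩ : {i : Fin r // (u i).card = 1}) ≠
      ⟨i₂, by rw [hi₂, Finset.card_singleton]⟩ := by
    intro h0; have h1 : i₁ = i₂ := congrArg Subtype.val h0
    rw [h1] at hi₁; rw [hi₁] at hi₂; exact hb12 (Finset.singleton_injective hi₂)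
  have hG12 : (⟨jG₁, hG₁b, by rw [Finset.mem_singleton]; exact hG₁s⟩ :
      {j : Fin r // 2 ≤ (w j).card ∧ j ∉ ({js} : Finset (Fin r))}) ≠ ⟨jG₂, hG₂b, by rw [Finset.mem_singleton]; exact hG₂s⟩ := by
    intro h0; have h1 : jG₁ = jG₂ := congrArg Subtype.val h0
    -- then `w jG₁ ⊇ {e₁, e₂} = w js`, both of size 2: equal, contradiction
    have hsub : w js ⊆ w jG₁ := by
      rw [hS]; intro x hx
      rcases Finset.mem_insert.mp hx with rfl | hx
      · exact he₁
      · rw [Finset.mem_singleton.mp hx, h1]; exact he₂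
    have := Finset.eq_of_subset_of_card_le hsub (by rw [hall2w js hbj, hall2w jG₁ hG₁b])
    exact hG₁s (hw this.symm)
  obtain ⟨β, hβ₁, hβ₂⟩ := exists_equiv_apply_eq₂ hcβ hi12 hG12
  let α : {j : Fin r // (w j).card = 1} ≃ {i : Fin r // 2 ≤ (u i).card ∧ i ∉ ({is} : Finset (Fin r))} :=
    Fintype.equivOfCardEq hcα
  refine starDet_ne_zero_of_singleton_design u w hu hw hlu hlw hr hbi hbj hmi hmj α β ?_
  refine one_le_twoTop_of_term _ _ (seatG_nonneg u w _) (seatD_nonneg u w _) subset_rfl (Finset.empty_subset _) ?_ ?_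
  · unfold scDeg tcPot bigInd
    rw [Finset.sdiff_empty, Finset.sdiff_self, Finset.card_empty, if_pos hbi, if_pos hbj, hall2u is hbi, hall2w js hbj]
  · rw [scCoef_allRows]
    refine one_le_prod_int _ _ fun e he => ?_
    rw [hS] at he
    rcases Finset.mem_insert.mp he with he' | he'
    · rw [he']
      have h1 := seatD_eq_one u w (fun i => (β i).1) ⟨i₁, by rw [hi₁, Finset.card_singleton]⟩ hi₁
        (show e₁ ∈ w (β ⟨i₁, by rw [hi₁, Finset.card_singleton]⟩).1 by rw [hβ₁]; exact he₁)
      calc (1 : ℤ) = seatD u w (fun i => (β i).1) ℤ b₁ e₁ := h1.symm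
        _ ≤ ∑ b ∈ u is, seatD u w (fun i => (β i).1) ℤ b e₁ :=
          Finset.single_le_sum (fun b _ => seatD_nonneg u w _ b e₁) (by rw [hA]; simp)
    · rw [Finset.mem_singleton] at he'; rw [he']
      have h1 := seatD_eq_one u w (fun i => (β i).1) ⟨i₂, by rw [hi₂, Finset.card_singleton]⟩ hi₂
        (show e₂ ∈ w (β ⟨i₂, by rw [hi₂, Finset.card_singleton]⟩).1 by rw [hβ₂]; exact he₂)
      calc (1 : ℤ) = seatD u w (fun i => (β i).1) ℤ b₂ e₂ := h1.symm
        _ ≤ ∑ b ∈ u is, seatD u w (fun i => (β i).1) ℤ b e₂ :=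
          Finset.single_le_sum (fun b _ => seatD_nonneg u w _ b e₂) (by rw [hA]; simp)

/-! ## 6. The theorem -/

/-- **EVERY LOWER PAIR OF EXCESS ONE IS STAR-GOOD** (`r = n₁ + n₂ + 2`). -/
theorem starDet_ne_zero_of_excessOne (hu : Function.Injective u) (hw : Function.Injective w)
    (hlu : IsLowerSet (Set.range u)) (hlw : IsLowerSet (Set.range w))
    (hε : r = (univ.filter fun i => (u i).card = 1).card + (univ.filter fun j => (w j).card = 1).card + 2) :
    ∃ g d : Fin h → Fin h → ℂ, (Matrix.of fun i j : Fin r => starEntry g d (u i) (w j)).det ≠ 0 := by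
  classical
  have hr : 0 < r := by omega
  -- the frame, for the pair and for its swap
  have frame : ∀ (u w : Fin r → Finset (Fin h)), Function.Injective u → Function.Injective w →
      IsLowerSet (Set.range u) → IsLowerSet (Set.range w) →
      r = (univ.filter fun i => (u i).card = 1).card + (univ.filter fun j => (w j).card = 1).card + 2 →
      ∃ is js : Fin r, 2 ≤ (u is).card ∧ 2 ≤ (w js).card ∧
        (∀ i', 2 ≤ (u i').card → (u i').card ≤ (u is).card) ∧ (∀ j', 2 ≤ (w j').card → (w j').card ≤ (w js).card) ∧
        (univ.filter fun i => 2 ≤ (u i).card).card = (univ.filter fun j => (w j).card = 1).card + 1 ∧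
        (univ.filter fun j => 2 ≤ (w j).card).card = (univ.filter fun i => (u i).card = 1).card + 1 := by
    intro u w hu hw hlu hlw hε
    obtain ⟨hp₁, hp₂⟩ := bigs_of_excessOne u w hu hw hlu hlw hr hε
    have hne₁ : (univ.filter fun i => 2 ≤ (u i).card).Nonempty := Finset.card_pos.mp (by omega)
    have hne₂ : (univ.filter fun j => 2 ≤ (w j).card).Nonempty := Finset.card_pos.mp (by omega)
    obtain ⟨is, his, hmi⟩ := Finset.exists_max_image _ (fun i => (u i).card) hne₁
    obtain ⟨js, hjs, hmj⟩ := Finset.exists_max_image _ (fun j => (w j).card) hne₂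
    exact ⟨is, js, (Finset.mem_filter.mp his).2, (Finset.mem_filter.mp hjs).2,
      fun i' hi' => hmi i' (Finset.mem_filter.mpr ⟨Finset.mem_univ _, hi'⟩),
      fun j' hj' => hmj j' (Finset.mem_filter.mpr ⟨Finset.mem_univ _, hj'⟩), hp₁, hp₂⟩
  have hε' : r = (univ.filter fun i => (w i).card = 1).card + (univ.filter fun j => (u j).card = 1).card + 2 := by omega
  obtain ⟨is, js, hbi, hbj, hmi, hmj, hp₁, hp₂⟩ := frame u w hu hw hlu hlw hε
  by_cases h3i : 3 ≤ (u is).card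
  · exact excessOne_case_rowThree u w hu hw hlu hlw hr hbi hbj hmi hmj hp₁ hp₂ h3i
  by_cases h3j : 3 ≤ (w js).card
  · obtain ⟨is', js', hbi', hbj', hmi', hmj', hp₁', hp₂'⟩ := frame w u hw hu hlw hlu hε'
    have h3' : 3 ≤ (w is').card := by have := hmi' js hbj; omega
    exact starGood_swap u w (excessOne_case_rowThree w u hw hu hlw hlu hr hbi' hbj' hmi' hmj' hp₁' hp₂' h3')
  -- both sides are graphs
  have hall2u : ∀ i, 2 ≤ (u i).card → (u i).card = 2 := fun i hi => by have := hmi i hi; omega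
  have hall2w : ∀ j, 2 ≤ (w j).card → (w j).card = 2 := fun j hj => by have := hmj j hj; omega
  by_cases hmore : (univ.filter fun j => (w j).card = 1).card < (univ.filter fun j => 2 ≤ (w j).card).card
  · exact excessOne_case_graphs u w hu hw hlu hlw hr hall2u hall2w hp₁ hp₂ hmore
  · have hmore' : (univ.filter fun i => (u i).card = 1).card < (univ.filter fun i => 2 ≤ (u i).card).card := by omega
    exact starGood_swap u w (excessOne_case_graphs w u hw hu hlw hlu hr hall2w hall2u hp₂ hp₁ hmore')

/-- **Door level:** excess-one injective lower pairs have `symbolicDet 2 ≠ 0`. -/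
theorem symbolicDet_two_ne_zero_of_excessOne (hu : Function.Injective u) (hw : Function.Injective w)
    (hlu : IsLowerSet (Set.range u)) (hlw : IsLowerSet (Set.range w))
    (hε : r = (univ.filter fun i => (u i).card = 1).card + (univ.filter fun j => (w j).card = 1).card + 2) :
    symbolicDet 2 h r u w ≠ 0 := by
  obtain ⟨g, d, hdet⟩ := starDet_ne_zero_of_excessOne u w hu hw hlu hlw hε
  exact symbolicDet_two_ne_zero_of_starDet g d u w hu hw hlu hlw hdet

/-- **Item level:** excess-one injective lower pairs are anchored hits at profile 2. -/
theorem anchoredHit_two_of_excessOne (hu : Function.Injective u) (hw : Function.Injective w)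
    (hlu : IsLowerSet (Set.range u)) (hlw : IsLowerSet (Set.range w))
    (hε : r = (univ.filter fun i => (u i).card = 1).card + (univ.filter fun j => (w j).card = 1).card + 2) :
    AnchoredHit 2 h r u w :=
  stub_genericPoint 2 h r u w (symbolicDet_two_ne_zero_of_excessOne u w hu hw hlu hlw hε)

/-- **STAR-LOWER up to excess one:** every injective lower pair with `r ≤ n₁ + n₂ + 2` is star-good. -/
theorem starDet_ne_zero_of_excess_le_one (hu : Function.Injective u) (hw : Function.Injective w)
    (hlu : IsLowerSet (Set.range u)) (hlw : IsLowerSet (Set.range w))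
    (hε : r ≤ (univ.filter fun i => (u i).card = 1).card + (univ.filter fun j => (w j).card = 1).card + 2) :
    ∃ g d : Fin h → Fin h → ℂ, (Matrix.of fun i j : Fin r => starEntry g d (u i) (w j)).det ≠ 0 := by
  by_cases h1 : r ≤ (univ.filter fun i => (u i).card = 1).card + (univ.filter fun j => (w j).card = 1).card + 1
  · exact starDet_ne_zero_of_vertexRich u w hu hw hlu hlw h1
  · exact starDet_ne_zero_of_excessOne u w hu hw hlu hlw (by omega)

end ExcessOne

end StarDoor

end

end Summit.ValiantsHypothesis.ValiantsHypothesis.Theorems.BarrierLever.AnchoredPeeling
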